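import Literature.AlgebraicGeometry.HodgeTheory.LefschetzOneOneChow
import Literature.NumberTheory.Transcendental.AnalytificationConnectedAffine
import Literature.AlgebraicGeometry.Resolution.AlterationsStrictTransformModel
import HarnessLib

/-!
# GAGA §5, first clause: the analytification of a closed subvariety is an analytic subset (proof)

Family `hodge`, layer `Literature/AlgebraicGeometry/HodgeTheory`. Proof file for the named fact
`isAnalyticSet_preimage_range_map_of_isClosedImmersion` of `LefschetzOneOneChow.lean` (Serre, GAGA
§2 n°5 p. 9: «Si `Y` est un sous-ensemble Z-localement fermé dans `X`, alors `Y^h` est un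
sous-ensemble analytique de `X^h`», first clause, for `Y` Z-closed), which is **discharged here**
(`isAnalyticSet_preimage_range_map_of_isClosedImmersion_holds`): for a closed immersion
`g : X ⟶ Y` of `k`-schemes (`k ⊆ ℂ`), `Y` locally of finite type, and an analytification
`ψ : M' → Y(ℂ)`, the set `ψ⁻¹(g(ℂ)(X(ℂ)))` is an analytic subset of `M'`.

The proof is Serre's n°5 Lemme 1 b) («tout sous-ensemble Z-localement fermé `Z` de `U` est
analytique»: «si `Z` est fermé dans `U`, il peut être défini par l'annulation d'un nombre fini de
polynômes, donc de fonctions holomorphes») transported to an abstract analytification, in two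
steps:

* `range_map_eq_setOf_pt_mem_range` — **complex points over the image of a closed immersion
  lift**: `g(ℂ)(X(ℂ)) = {Q ∈ Y(ℂ) | Q.pt ∈ g(X)}`. A morphism `Spec L → Y` from a reduced scheme
  with image in `g(X)` factors through the closed immersion `g` (the tree's
  `Literature.AlgebraicGeometry.Resolution.IsClosedImmersion.liftOfRange`, Mathlib
  `IsClosedImmersion.lift` with the kernel comparison for reduced sources).
* `isAnalyticSet_preimage_setOf_pt_mem` — **Zariski-closed sets are analytic**: for `T ⊆ Y`
  closed, `ψ⁻¹{Q | Q.pt ∈ T}` is an analytic subset of `M'`. Near `p ∈ M'` choose an affine open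
  `U ∋ (ψ p).pt`; the ideal of `T` on `U` (Mathlib's vanishing ideal sheaf,
  `Scheme.IdealSheafData.vanishingIdeal`) is finitely generated (`Y` is locally Noetherian,
  Mathlib `LocallyOfFiniteType.isLocallyNoetherian`), membership of a complex point of `U` in `T`
  is the vanishing of that ideal (`AlgPoints.pt_mem_iff_forall_eval_eq_zero`, from Mathlib
  `IdealSheafData.mem_support_iff_of_mem`), hence of its generators (evaluation is a ring
  homomorphism), and the generators pull back to holomorphic functions on `ψ⁻¹(U(ℂ))` by the
  definition of an analytification (`IsAnalytification.mdifferentiableOn_evalOrZero`).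

## References

* [SerreGAGA1956] J.-P. Serre, Géométrie algébrique et géométrie analytique, Ann. Inst. Fourier 6
  (1956), §2 n°5: Lemme 1 b) (p. 8) and p. 9 («`Y^h` est un sous-ensemble analytique de `X^h`»).
* [Hartshorne1977] R. Hartshorne, Algebraic Geometry, II Ex. 2.7, Ex. 3.11 (closed immersions),
  Cor. 5.10.
-/

noncomputable section

open scoped Manifold ContDiff
open CategoryTheory AlgebraicGeometry TopologicalSpace
open Literature.AlgebraicGeometry.Motives (AlgPoints ComplexPoints SchemeOver)
open Literature.NumberTheory.Transcendental (IsAnalytification)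
open Literature.Geometry.Kaehler (IsAnalyticSet IsAnalyticSetAt)

universe u

namespace Literature.AlgebraicGeometry.HodgeTheory

section HodgeTheory

/-! ### Complex points over the image of a closed immersion lift -/

section Lift

open Literature.AlgebraicGeometry.Resolution (IsClosedImmersion.liftOfRange
  IsClosedImmersion.liftOfRange_fac)

variable {k : Type u} [Field k] {X Y : SchemeOver k} {L : Type u} [Field L] [Algebra k L]

/-- **`L`-points over the image of a closed immersion lift.** For a closed immersion `g : X ⟶ Y`
of `k`-schemes and any field `L ⊇ k`, the image of `g(L) : X(L) → Y(L)` consists exactly of the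
`L`-points of `Y` whose underlying point lies in `g(X)`: `Spec L` is reduced, so a morphism
`Spec L → Y` with image in `g(X)` factors through `g` (the tree's
`Resolution.IsClosedImmersion.liftOfRange`, from Mathlib `IsClosedImmersion.lift`; cf. Hartshorne
II Ex. 2.7, Ex. 3.11). [folklore] -/
theorem range_map_eq_setOf_pt_mem_range (g : X ⟶ Y) [IsClosedImmersion g.left] :
    Set.range (AlgPoints.map g : AlgPoints X L → AlgPoints Y L) = {Q | Q.pt ∈ Set.range g.left} := by
  ext Q
  constructor
  · rintro ⟨P, rfl⟩
    exact ⟨P.pt, rfl⟩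
  · rintro ⟨x, hx⟩
    have hsub : Set.range Q.toSpecHom ⊆ Set.range g.left := by
      rintro _ ⟨z, rfl⟩
      obtain rfl : z = IsLocalRing.closedPoint L := Subsingleton.elim _ _
      exact ⟨x, hx⟩
    have hl : IsClosedImmersion.liftOfRange g.left Q.toSpecHom hsub ≫ g.left = Q.toSpecHom :=
      IsClosedImmersion.liftOfRange_fac _ _ _
    refine ⟨AlgPoints.mk (IsClosedImmersion.liftOfRange g.left Q.toSpecHom hsub) ?_, ?_⟩
    · rw [← Over.w g, ← Category.assoc, hl]
      exact Over.w Q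
    · ext : 1
      rw [AlgPoints.map_apply, Over.comp_left]
      exact hl

end Lift

/-! ### Zariski-closed sets are analytic in an analytification -/

section Closed

variable {k : Type} [Field k] [Algebra k ℂ] {Y : SchemeOver k}
  {E' : Type*} [NormedAddCommGroup E'] [NormedSpace ℂ E'] [FiniteDimensional ℂ E']
  {M' : Type*} [TopologicalSpace M'] [ChartedSpace E' M'] {e : ℕ} {ψ : M' → ComplexPoints Y}

/-- **Zariski-closed sets are analytic** (Serre, GAGA §2 n°5 Lemme 1 b): «tout sous-ensemble
Z-localement fermé `Z` de `U` est analytique» — «si `Z` est fermé dans `U`, il peut être défini par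
l'annulation d'un nombre fini de polynômes, donc de fonctions holomorphes», here for an abstract
analytification). Let `Y` be locally of finite type over `k ⊆ ℂ`, `ψ : M' → Y(ℂ)` an
analytification and `T ⊆ Y` a closed subset. Then `ψ⁻¹{Q | Q.pt ∈ T}` is an analytic subset of
`M'`: near `p`, on an affine open `U ∋ (ψ p).pt`, it is cut out by finitely many generators of the
ideal of `T` on `U` (`Y` is locally Noetherian), which are holomorphic on `ψ⁻¹(U(ℂ))`.
[cite: SerreGAGA1956, §2 n°5 Lemme 1 b)] -/
theorem isAnalyticSet_preimage_setOf_pt_mem [LocallyOfFiniteType Y.hom]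
    (hψ : IsAnalytification E' Y e ψ) {T : Set Y.left} (hT : IsClosed T) :
    IsAnalyticSet 𝓘(ℂ, E') (ψ ⁻¹' {Q | Q.pt ∈ T}) := by
  classical
  haveI : IsLocallyNoetherian Y.left := LocallyOfFiniteType.isLocallyNoetherian Y.hom
  intro p
  -- an affine open `U ∋ (ψ p).pt` and generators of the ideal of `T` on `U`
  obtain ⟨_, ⟨U, hU, rfl⟩, hpU, -⟩ :=
    Y.left.isBasis_affineOpens.exists_subset_of_mem_open (Set.mem_univ (ψ p).pt) isOpen_univ
  haveI : IsNoetherianRing Γ(Y.left, U) := IsLocallyNoetherian.component_noetherian ⟨U, hU⟩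
  obtain ⟨s, hs⟩ := (isNoetherianRing_iff_ideal_fg Γ(Y.left, U)).mp ‹_›
    ((Scheme.IdealSheafData.vanishingIdeal ⟨T, hT⟩).ideal ⟨U, hU⟩)
  -- the local equations: the generators, pulled back along `ψ`
  refine IsAnalyticSetAt.of_fintype (ι := ↥s) (hψ.isOpen_preimage U) hpU
    (fun q a ↦ AlgPoints.evalOrZero U (a : Γ(Y.left, U)) (ψ q))
    (fun a ↦ hψ.mdifferentiableOn_evalOrZero ⟨U, hU⟩ a) ?_
  ext q
  simp only [Set.mem_inter_iff, Set.mem_preimage, Set.mem_setOf_eq]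
  constructor
  · rintro ⟨hqT, hqU⟩
    refine ⟨hqU, fun a ↦ ?_⟩
    rw [AlgPoints.evalOrZero_of_mem _ hqU]
    exact (AlgPoints.pt_mem_iff_forall_eval_eq_zero hU hT (ψ q) hqU).mp hqT a
      (hs ▸ Ideal.subset_span a.2)
  · rintro ⟨hqU, hzero⟩
    refine ⟨(AlgPoints.pt_mem_iff_forall_eval_eq_zero hU hT (ψ q) hqU).mpr fun f hf ↦ ?_, hqU⟩
    -- `f ∈ J = span s` and evaluation at `ψ q` is a ring homomorphism killing `s`
    have hle : (Scheme.IdealSheafData.vanishingIdeal ⟨T, hT⟩).ideal ⟨U, hU⟩ ≤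
        RingHom.ker ((ψ q).evalRingHom U hqU) := by
      rw [← hs, Ideal.span_le]
      intro a ha
      have := hzero ⟨a, ha⟩
      rw [AlgPoints.evalOrZero_of_mem _ hqU] at this
      exact this
    exact hle hf

/-- **Discharge of `isAnalyticSet_preimage_range_map_of_isClosedImmersion`** (Serre, GAGA §2 n°5
p. 9, first clause: «`Y^h` est un sous-ensemble analytique de `X^h`» for `Y` Z-closed in `X`; here
for a closed immersion `g : X ⟶ Y` of `k`-schemes, `Y` locally of finite type, and an
analytification `ψ` of `Y`): `ψ⁻¹(g(ℂ)(X(ℂ))) = ψ⁻¹{Q | Q.pt ∈ g(X)}`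
(`range_map_eq_setOf_pt_mem_range`) with `g(X)` closed, which is analytic by
`isAnalyticSet_preimage_setOf_pt_mem` (n°5 Lemme 1 b)). [cite: SerreGAGA1956, §2 n°5 p. 9 and Lemme 1 b)] -/
theorem isAnalyticSet_preimage_range_map_of_isClosedImmersion_holds :
    isAnalyticSet_preimage_range_map_of_isClosedImmersion := by
  intro k _ _ X Y g _ _ E' _ _ _ M' _ _ e ψ hψ
  rw [range_map_eq_setOf_pt_mem_range g]
  exact isAnalyticSet_preimage_setOf_pt_mem hψ g.left.isClosedEmbedding.isClosed_range

end Closed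

end HodgeTheory

end Literature.AlgebraicGeometry.HodgeTheory

end
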